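import Summits.Parity.BatemanHorn.Theorems.AlmostPrimeZerosSystemMomentDeficitAssemblyAlgebra

/-!
# Crux `SystemMomentDeficit` (stmt-Parity-11326): two-sided localisation, covariance lemmas

Finite-probability lemmas over the uniform measure on `0 ≤ n ≤ x` for the TWO-SIDED localisation
of the moment deficit (`AlmostPrimeZerosSystemMomentDeficitLocalisation.lean`):

* `deficit_le_mean`, `neg_sq_le_deficit`, `variance_le_sq` — the deficit / variance block of a
  bounded nonnegative variable `0 ≤ b ≤ K` (`−K² ≤ E b − Var b ≤ E b`, `Var b ≤ K²`);
* `cov_sq_le_variance_mul_variance`, `abs_cov_le_sqrt_mul_sqrt` — Cauchy–Schwarz for the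
  empirical covariance, `Cov(a, b)² ≤ Var a · Var b`.

Notation (docstrings only).  `Y = x + 1`, `E g = Y⁻¹ Σ_{0 ≤ n ≤ x} g(n)`,
`Var g = E g² − (E g)²`, `Cov(g, h) = E(gh) − E g · E h`.  Everything is [folklore].
-/

namespace Summit.Parity.BatemanHorn.Cruxes.SystemMomentDeficit.Localisation

open scoped BigOperators
open Finset
open Summit.Parity.BatemanHorn.Cruxes.SystemMomentDeficit.Ideator3Sketch

/-! ### Block of a bounded nonnegative variable -/

/-- For any `b`: `E b − E b² + (E b)² ≤ E b` (the variance is nonnegative). [folklore] -/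
theorem deficit_le_mean (x : ℕ) (b : ℕ → ℝ) :
    (∑ n ∈ range (x + 1), b n) / ((x : ℝ) + 1) - (∑ n ∈ range (x + 1), b n ^ 2) / ((x : ℝ) + 1) +
        ((∑ n ∈ range (x + 1), b n) / ((x : ℝ) + 1)) ^ 2 ≤
      (∑ n ∈ range (x + 1), b n) / ((x : ℝ) + 1) := by
  linarith [sq_mean_le_mean_sq x b]

/-- For `0 ≤ b ≤ K` pointwise: `E b² ≤ K · E b ≤ K²`, hence `−K² ≤ E b − E b² + (E b)²`. [folklore] -/
theorem neg_sq_le_deficit (x : ℕ) (b : ℕ → ℝ) (K : ℝ) (hb0 : ∀ n ∈ range (x + 1), 0 ≤ b n)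
    (hbK : ∀ n ∈ range (x + 1), b n ≤ K) :
    -K ^ 2 ≤
      (∑ n ∈ range (x + 1), b n) / ((x : ℝ) + 1) - (∑ n ∈ range (x + 1), b n ^ 2) / ((x : ℝ) + 1) +
        ((∑ n ∈ range (x + 1), b n) / ((x : ℝ) + 1)) ^ 2 := by
  have hY0 : (0 : ℝ) < (x : ℝ) + 1 := by positivity
  have h1 : 0 ≤ (∑ n ∈ range (x + 1), b n) / ((x : ℝ) + 1) := div_nonneg (sum_nonneg hb0) hY0.le
  have h2 : (∑ n ∈ range (x + 1), b n ^ 2) / ((x : ℝ) + 1) ≤ K ^ 2 := by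
    rw [div_le_iff₀ hY0]
    calc ∑ n ∈ range (x + 1), b n ^ 2 ≤ ∑ _n ∈ range (x + 1), K ^ 2 :=
          sum_le_sum fun n hn => pow_le_pow_left₀ (hb0 n hn) (hbK n hn) 2
      _ = K ^ 2 * ((x : ℝ) + 1) := by rw [sum_const, card_range, nsmul_eq_mul]; push_cast; ring
  nlinarith

/-- For `0 ≤ b ≤ K` pointwise: `Var b = E b² − (E b)² ≤ K²`. [folklore] -/
theorem variance_le_sq (x : ℕ) (b : ℕ → ℝ) (K : ℝ) (hb0 : ∀ n ∈ range (x + 1), 0 ≤ b n)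
    (hbK : ∀ n ∈ range (x + 1), b n ≤ K) :
    (∑ n ∈ range (x + 1), b n ^ 2) / ((x : ℝ) + 1) - ((∑ n ∈ range (x + 1), b n) / ((x : ℝ) + 1)) ^ 2 ≤
      K ^ 2 := by
  have h := neg_sq_le_deficit x b K hb0 hbK
  have hY0 : (0 : ℝ) < (x : ℝ) + 1 := by positivity
  have h1 : (∑ n ∈ range (x + 1), b n) / ((x : ℝ) + 1) ≤ K := by
    rw [div_le_iff₀ hY0]
    calc ∑ n ∈ range (x + 1), b n ≤ ∑ _n ∈ range (x + 1), K := sum_le_sum hbK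
      _ = K * ((x : ℝ) + 1) := by rw [sum_const, card_range, nsmul_eq_mul]; push_cast; ring
  have h0 : 0 ≤ (∑ n ∈ range (x + 1), b n) / ((x : ℝ) + 1) := div_nonneg (sum_nonneg hb0) hY0.le
  have hsq : (∑ n ∈ range (x + 1), b n ^ 2) / ((x : ℝ) + 1) ≤ K * ((∑ n ∈ range (x + 1), b n) / ((x : ℝ) + 1)) := by
    rw [mul_div_assoc', div_le_div_iff_of_pos_right hY0, mul_sum]
    exact sum_le_sum fun n hn => by
      rw [sq]
      exact mul_le_mul_of_nonneg_right (hbK n hn) (hb0 n hn)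
  nlinarith

/-! ### Cauchy–Schwarz for the empirical covariance -/

/-- **Cauchy–Schwarz**: `Cov(a, b)² ≤ Var a · Var b` for the uniform measure on `0 ≤ n ≤ x`. [folklore] -/
theorem cov_sq_le_variance_mul_variance :
    ∀ (x : ℕ) (a b : ℕ → ℝ),
    ((∑ n ∈ range (x + 1), a n * b n) / ((x : ℝ) + 1) -
        (∑ n ∈ range (x + 1), a n) / ((x : ℝ) + 1) * ((∑ n ∈ range (x + 1), b n) / ((x : ℝ) + 1))) ^ 2 ≤
      ((∑ n ∈ range (x + 1), a n ^ 2) / ((x : ℝ) + 1) - ((∑ n ∈ range (x + 1), a n) / ((x : ℝ) + 1)) ^ 2) *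
        ((∑ n ∈ range (x + 1), b n ^ 2) / ((x : ℝ) + 1) - ((∑ n ∈ range (x + 1), b n) / ((x : ℝ) + 1)) ^ 2) := by
  intro x a b
  have hY0 : (0 : ℝ) < (x : ℝ) + 1 := by positivity
  set Y : ℝ := (x : ℝ) + 1 with hY
  set ma : ℝ := (∑ n ∈ range (x + 1), a n) / Y with hma
  set mb : ℝ := (∑ n ∈ range (x + 1), b n) / Y with hmb
  have hcard : ∑ _n ∈ range (x + 1), (1 : ℝ) = Y := by rw [sum_const, card_range, nsmul_eq_mul, mul_one]; push_cast; ring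
  have hsa : ∑ n ∈ range (x + 1), a n = Y * ma := by rw [hma]; field_simp
  have hsb : ∑ n ∈ range (x + 1), b n = Y * mb := by rw [hmb]; field_simp
  -- centred identities
  have e1 : ∑ n ∈ range (x + 1), (a n - ma) * (b n - mb) = ∑ n ∈ range (x + 1), a n * b n - Y * ma * mb := by
    have : ∀ n, (a n - ma) * (b n - mb) = a n * b n - mb * a n - ma * b n + ma * mb * 1 := fun n => by ring
    simp_rw [this]
    rw [sum_add_distrib, sum_sub_distrib, sum_sub_distrib, ← mul_sum, ← mul_sum, ← mul_sum, hsa, hsb, hcard]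
    ring
  have e2 : ∑ n ∈ range (x + 1), (a n - ma) ^ 2 = ∑ n ∈ range (x + 1), a n ^ 2 - Y * ma ^ 2 := by
    have : ∀ n, (a n - ma) ^ 2 = a n ^ 2 - 2 * ma * a n + ma ^ 2 * 1 := fun n => by ring
    simp_rw [this]
    rw [sum_add_distrib, sum_sub_distrib, ← mul_sum, ← mul_sum, hsa, hcard]
    ring
  have e3 : ∑ n ∈ range (x + 1), (b n - mb) ^ 2 = ∑ n ∈ range (x + 1), b n ^ 2 - Y * mb ^ 2 := by
    have : ∀ n, (b n - mb) ^ 2 = b n ^ 2 - 2 * mb * b n + mb ^ 2 * 1 := fun n => by ring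
    simp_rw [this]
    rw [sum_add_distrib, sum_sub_distrib, ← mul_sum, ← mul_sum, hsb, hcard]
    ring
  have hCS := sum_mul_sq_le_sq_mul_sq (range (x + 1)) (fun n => a n - ma) (fun n => b n - mb)
  rw [e1, e2, e3] at hCS
  have eL : (∑ n ∈ range (x + 1), a n * b n) / Y - ma * mb = (∑ n ∈ range (x + 1), a n * b n - Y * ma * mb) / Y := by
    field_simp
  have eA : (∑ n ∈ range (x + 1), a n ^ 2) / Y - ma ^ 2 = (∑ n ∈ range (x + 1), a n ^ 2 - Y * ma ^ 2) / Y := by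
    field_simp
  have eB : (∑ n ∈ range (x + 1), b n ^ 2) / Y - mb ^ 2 = (∑ n ∈ range (x + 1), b n ^ 2 - Y * mb ^ 2) / Y := by
    field_simp
  rw [eL, eA, eB, div_pow, div_mul_div_comm]
  have hY2 : Y ^ 2 = Y * Y := sq Y
  rw [hY2]
  exact div_le_div_of_nonneg_right hCS (mul_pos hY0 hY0).le

/-- **Cauchy–Schwarz**, square-root form: `|Cov(a, b)| ≤ √(Var a) · √(Var b)`. [folklore] -/
theorem abs_cov_le_sqrt_mul_sqrt (x : ℕ) (a b : ℕ → ℝ) :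
    |(∑ n ∈ range (x + 1), a n * b n) / ((x : ℝ) + 1) -
        (∑ n ∈ range (x + 1), a n) / ((x : ℝ) + 1) * ((∑ n ∈ range (x + 1), b n) / ((x : ℝ) + 1))| ≤
      Real.sqrt ((∑ n ∈ range (x + 1), a n ^ 2) / ((x : ℝ) + 1) - ((∑ n ∈ range (x + 1), a n) / ((x : ℝ) + 1)) ^ 2) *
        Real.sqrt ((∑ n ∈ range (x + 1), b n ^ 2) / ((x : ℝ) + 1) - ((∑ n ∈ range (x + 1), b n) / ((x : ℝ) + 1)) ^ 2) := by
  have h := cov_sq_le_variance_mul_variance x a b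
  have hA : 0 ≤ (∑ n ∈ range (x + 1), a n ^ 2) / ((x : ℝ) + 1) - ((∑ n ∈ range (x + 1), a n) / ((x : ℝ) + 1)) ^ 2 := by
    linarith [sq_mean_le_mean_sq x a]
  rw [← Real.sqrt_mul hA, ← Real.sqrt_sq_eq_abs]
  exact Real.sqrt_le_sqrt h

end Summit.Parity.BatemanHorn.Cruxes.SystemMomentDeficit.Localisation
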